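import Literature.NumberTheory.LFunctions.WeilGroundEnergyParitySplit
import HarnessLib

/-!
# PF persistence — THE TOWER LAW, TYPED (qualitative form of pf's PF-C9; barrier-typer gen 11)

Cell `pub-rhpf` (long-odds MECHANISM SEARCH; **no RH claims**).  The pf seat (PF.md §17.6 / §18.1,
INVARIANT-CANDIDATES rows PF-C9, PF-C9 amendment 2) measured a DATA law for the parity tower of the windowed
Weil form: `lg(ε₁⁻/ε₁⁺)(a) = 2 lg(2πe^{2a} − 9/2) + 0.200 ± 0.04` on the served windows, i.e. the odd bottom
level dominates the even one by a factor growing like `e^{4a}`.  On request (pf INBOX 2026-08-19T21:24:25Z,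
answering the typer's verdict V10) this file TYPES the law's QUALITATIVE content, with NO constants typed, as
Props PARAMETRISED by two level functions `εev εod : ℝ → ℝ` (so that nothing closed is asserted or even named
about `ζ`), records the intended instance — the tree's continuum sector bottoms
`εev = weilEvenGroundEnergy`, `εod = weilOddGroundEnergy`
(`Literature/NumberTheory/LFunctions/WeilGroundEnergyParitySplit.lean`, `…/WeilOddGroundState.lean`) — in
unfolding lemmas, and proves the few lines of kernel algebra that say WHERE A SIGN INPUT ENTERS.

* §1 (TYPED) `towerRatio εev εod a := εod a / εev a`; `TowerDominance εev εod := towerRatio → +∞`;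
  `TowerLogLaw εev εod := log (towerRatio a) ~ 4a` (natural log: `2 log(2πe^{2a}) = 4a + 2 log 2π`);
  `EventualParityMargin εev εod σ := ∀ᶠ a, εev a < σ·εod a` (the condition pf's AMP chain consumes, PF-C8:
  `s_c = σ ε₁⁻`, `σ ≈ 0.98`).  HYPOTHESES / DATA-shaped statements, asserted nowhere.
* §2 (PROVED, elementary) `TowerLogLaw` is SIGN-BLIND (`Real.log x = Real.log |x|`): it is the same statement
  for `|towerRatio|` and yields only `|towerRatio| → ∞`; `TowerDominance` fixes the RELATIVE sign (eventually
  `εod` and `εev` are non-zero of the same sign) but not the common sign; the log law plus an eventual relative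
  sign gives dominance.
* §3 (PROVED, elementary) THE SIGN INPUT: dominance + eventual POSITIVITY of `εev` gives
  `EventualParityMargin σ` for EVERY `σ > 0`; dominance + eventual NEGATIVITY of `εev` gives the REVERSED margin
  `σ·εod < εev` for every `σ > 0`.  So the parity-margin step of pf's chain (dominance ∧ AMP-pinning ⇒ cofinal
  one-signedness, via `PolarPerronFrobenius.pos_of_ampWidth`) needs an eventual-positivity binder for the even
  sector — the typed place where the law is "RH-shaped" (verdict V10).
* §4 the `ζ` instance, by unfolding only.

No statement about the truth of any of these Props for `ζ`; no numerical datum is used.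
-/

set_option linter.dupNamespace false  -- the mandated namespace repeats `RiemannHypothesis`

noncomputable section

open Filter Asymptotics Real

open Literature.NumberTheory.LFunctions

namespace Summit.RiemannHypothesis.RiemannHypothesis.Theorems.PfPersistence

variable {εev εod : ℝ → ℝ}

/-! ## §1 The typed objects (parametrised by the two level functions) -/

/-- TYPED (pf PF-C9, qualitative): the PARITY-TOWER RATIO `r(a) := εod a / εev a` of two level functions
(junk `0` where `εev a = 0`, by `x / 0 = 0`). -/
def towerRatio (εev εod : ℝ → ℝ) (a : ℝ) : ℝ := εod a / εev a

/-- TYPED (pf PF-C9, qualitative; a HYPOTHESIS on the pair `(εev, εod)`, asserted for no pair): TOWER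
DOMINANCE — `εod a / εev a → +∞` as `a → ∞`. -/
def TowerDominance (εev εod : ℝ → ℝ) : Prop := Tendsto (towerRatio εev εod) atTop atTop

/-- TYPED (pf PF-C9, qualitative; a HYPOTHESIS, asserted for no pair): the TOWER LOG LAW —
`log (εod a / εev a) ~ 4a` (natural logarithm; pf's DATA for `ζ`: `= 2 log(2πe^{2a} − 9/2) + O(1)`).  Mathlib's
`Real.log` is `log |·|`, so this Prop is SIGN-BLIND (`towerLogLaw_iff_abs`). -/
def TowerLogLaw (εev εod : ℝ → ℝ) : Prop :=
  (fun a : ℝ => Real.log (towerRatio εev εod a)) ~[atTop] fun a : ℝ => 4 * a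

/-- TYPED (the condition pf's AMP chain consumes, PF-C8 with `s_c = σ·ε₁⁻`; a HYPOTHESIS, asserted for no
pair): EVENTUAL PARITY MARGIN with slack `σ` — `εev a < σ·εod a` for all large `a`. -/
def EventualParityMargin (εev εod : ℝ → ℝ) (σ : ℝ) : Prop := ∀ᶠ a in atTop, εev a < σ * εod a

/-- PROVED (unfolding). [folklore] -/
theorem towerRatio_def (a : ℝ) : towerRatio εev εod a = εod a / εev a := rfl

/-- PROVED (unfolding). [folklore] -/
theorem towerDominance_iff : TowerDominance εev εod ↔ Tendsto (towerRatio εev εod) atTop atTop := Iff.rfl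

/-- PROVED (unfolding). [folklore] -/
theorem towerLogLaw_iff :
    TowerLogLaw εev εod ↔ (fun a : ℝ => Real.log (towerRatio εev εod a)) ~[atTop] fun a : ℝ => 4 * a :=
  Iff.rfl

/-- PROVED (unfolding). [folklore] -/
theorem eventualParityMargin_iff {σ : ℝ} :
    EventualParityMargin εev εod σ ↔ ∀ᶠ a in atTop, εev a < σ * εod a := Iff.rfl

/-! ## §2 Sign-blindness of the log law; relative sign from dominance -/

/-- PROVED: the log law is SIGN-BLIND — it is literally the same statement for `|r(a)|`
(`Real.log |x| = Real.log x`). [folklore] -/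
theorem towerLogLaw_iff_abs :
    TowerLogLaw εev εod ↔ (fun a : ℝ => Real.log |towerRatio εev εod a|) ~[atTop] fun a : ℝ => 4 * a := by
  have h : (fun a : ℝ => Real.log |towerRatio εev εod a|) = fun a : ℝ => Real.log (towerRatio εev εod a) :=
    funext fun a => Real.log_abs _
  rw [h]; rfl

/-- PROVED: under the log law, `log r(a) → +∞`. [folklore] -/
theorem TowerLogLaw.tendsto_log (h : TowerLogLaw εev εod) :
    Tendsto (fun a : ℝ => Real.log (towerRatio εev εod a)) atTop atTop :=
  (Asymptotics.IsEquivalent.tendsto_atTop_iff h).2 (tendsto_id.const_mul_atTop four_pos)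

/-- PROVED: under the log law the MODULUS of the ratio tends to infinity — and that is all the log law says
about size (no sign). [folklore] -/
theorem TowerLogLaw.tendsto_abs (h : TowerLogLaw εev εod) :
    Tendsto (fun a : ℝ => |towerRatio εev εod a|) atTop atTop := by
  rw [tendsto_atTop]
  intro B
  have hev : ∀ᶠ a in atTop, Real.log (max B 2) ≤ Real.log (towerRatio εev εod a) :=
    (tendsto_atTop.1 h.tendsto_log) _
  filter_upwards [hev] with a ha
  have hB2 : (1 : ℝ) < max B 2 := lt_of_lt_of_le one_lt_two (le_max_right _ _)
  have hB0 : (0 : ℝ) < max B 2 := lt_trans one_pos hB2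
  have hlogpos : 0 < Real.log (max B 2) := Real.log_pos hB2
  have ha' : Real.log (max B 2) ≤ Real.log |towerRatio εev εod a| := by rwa [Real.log_abs]
  -- `|r a|` is not `0`, since its log is positive
  have habs_pos : 0 < |towerRatio εev εod a| := by
    rcases (abs_nonneg (towerRatio εev εod a)).eq_or_lt with h0 | h0
    · exfalso
      rw [← h0, Real.log_zero] at ha'
      exact absurd ha' (not_le.2 hlogpos)
    · exact h0
  exact le_trans (le_max_left _ _) ((Real.log_le_log_iff hB0 habs_pos).1 ha')

/-- PROVED: tower dominance fixes the RELATIVE sign — eventually `r(a) > 0`. [folklore] -/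
theorem TowerDominance.eventually_pos (h : TowerDominance εev εod) :
    ∀ᶠ a in atTop, 0 < towerRatio εev εod a :=
  h.eventually_gt_atTop 0

/-- PROVED: eventually the two levels are non-zero and of the SAME sign: `0 < εod a · εev a`. [folklore] -/
theorem TowerDominance.eventually_mul_pos (h : TowerDominance εev εod) :
    ∀ᶠ a in atTop, 0 < εod a * εev a := by
  filter_upwards [h.eventually_pos] with a ha
  have hne : εev a ≠ 0 := by
    intro h0; rw [towerRatio_def, h0, div_zero] at ha; exact lt_irrefl _ ha
  have := mul_pos ha (mul_self_pos.2 hne)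
  rwa [towerRatio_def, div_mul_eq_mul_div, mul_div_assoc, mul_self_div_self] at this

/-- PROVED: the log law together with an eventual relative sign IS tower dominance. [folklore] -/
theorem TowerLogLaw.towerDominance_of_eventually_pos (h : TowerLogLaw εev εod)
    (hpos : ∀ᶠ a in atTop, 0 < towerRatio εev εod a) : TowerDominance εev εod := by
  refine h.tendsto_abs.congr' ?_
  filter_upwards [hpos] with a ha
  exact abs_of_pos ha

/-! ## §3 Where the sign input enters the parity margin -/

/-- PROVED (THE SIGN INPUT, positive side): tower dominance plus EVENTUAL POSITIVITY of the even level gives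
the eventual parity margin with EVERY slack `σ > 0`. [folklore] -/
theorem TowerDominance.eventualParityMargin (h : TowerDominance εev εod)
    (hev : ∀ᶠ a in atTop, 0 < εev a) {σ : ℝ} (hσ : 0 < σ) : EventualParityMargin εev εod σ := by
  have hr : ∀ᶠ a in atTop, σ⁻¹ < towerRatio εev εod a := h.eventually_gt_atTop _
  filter_upwards [hr, hev] with a ha hpos
  have hne : εev a ≠ 0 := ne_of_gt hpos
  have hod : εod a = towerRatio εev εod a * εev a := by rw [towerRatio_def, div_mul_cancel₀ _ hne]
  rw [hod, ← mul_assoc]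
  have h1 : 1 < σ * towerRatio εev εod a := by
    have := mul_lt_mul_of_pos_left ha hσ
    rwa [mul_inv_cancel₀ (ne_of_gt hσ)] at this
  calc εev a = 1 * εev a := (one_mul _).symm
    _ < σ * towerRatio εev εod a * εev a := mul_lt_mul_of_pos_right h1 hpos

/-- PROVED (THE SIGN INPUT, negative side): tower dominance plus EVENTUAL NEGATIVITY of the even level gives
the REVERSED margin `σ·εod a < εev a` for every `σ > 0` — dominance alone decides no parity margin.
[folklore] -/
theorem TowerDominance.eventually_reversed_margin (h : TowerDominance εev εod)
    (hev : ∀ᶠ a in atTop, εev a < 0) {σ : ℝ} (hσ : 0 < σ) :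
    ∀ᶠ a in atTop, σ * εod a < εev a := by
  have hr : ∀ᶠ a in atTop, σ⁻¹ < towerRatio εev εod a := h.eventually_gt_atTop _
  filter_upwards [hr, hev] with a ha hneg
  have hne : εev a ≠ 0 := ne_of_lt hneg
  have hod : εod a = towerRatio εev εod a * εev a := by rw [towerRatio_def, div_mul_cancel₀ _ hne]
  rw [hod, ← mul_assoc]
  have h1 : 1 < σ * towerRatio εev εod a := by
    have := mul_lt_mul_of_pos_left ha hσ
    rwa [mul_inv_cancel₀ (ne_of_gt hσ)] at this
  calc σ * towerRatio εev εod a * εev a < 1 * εev a := mul_lt_mul_of_neg_right h1 hneg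
    _ = εev a := one_mul _

/-- PROVED: conversely an eventual parity margin with a slack `0 ≤ σ ≤ 1`, at arguments where the even level is
positive, forces the parity ORDER `εev a < εod a` there — nothing more. [folklore] -/
theorem EventualParityMargin.eventually_lt {σ : ℝ} (h : EventualParityMargin εev εod σ) (hσ0 : 0 ≤ σ)
    (hσ1 : σ ≤ 1) (hev : ∀ᶠ a in atTop, 0 < εev a) : ∀ᶠ a in atTop, εev a < εod a := by
  filter_upwards [h, hev] with a ha hpos
  have hod : 0 < εod a := by
    by_contra hle
    have hle' : εod a ≤ 0 := not_lt.1 hle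
    have : σ * εod a ≤ 0 := by nlinarith
    linarith
  calc εev a < σ * εod a := ha
    _ ≤ 1 * εod a := mul_le_mul_of_nonneg_right hσ1 hod.le
    _ = εod a := one_mul _

/-! ## §4 The intended instance: the continuum sector bottoms of the windowed Weil form (unfolding only) -/

/-- PROVED (unfolding; records the INTENDED INSTANCE of pf's PF-C9 — `εev = ε_ev = weilEvenGroundEnergy`,
`εod = ε_od = weilOddGroundEnergy`; nothing is asserted about it). [folklore] -/
theorem towerDominance_weil_iff :
    TowerDominance weilEvenGroundEnergy weilOddGroundEnergy ↔
      Tendsto (fun a : ℝ => weilOddGroundEnergy a / weilEvenGroundEnergy a) atTop atTop := Iff.rfl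

/-- PROVED (unfolding; the intended instance of the log law). [folklore] -/
theorem towerLogLaw_weil_iff :
    TowerLogLaw weilEvenGroundEnergy weilOddGroundEnergy ↔
      (fun a : ℝ => Real.log (weilOddGroundEnergy a / weilEvenGroundEnergy a)) ~[atTop]
        fun a : ℝ => 4 * a := Iff.rfl

/-- PROVED (unfolding; the intended instance of the parity margin). [folklore] -/
theorem eventualParityMargin_weil_iff {σ : ℝ} :
    EventualParityMargin weilEvenGroundEnergy weilOddGroundEnergy σ ↔
      ∀ᶠ a in atTop, weilEvenGroundEnergy a < σ * weilOddGroundEnergy a := Iff.rfl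

/-- PROVED (the instance of §3 that pf's chain would cite): for the Weil sector bottoms, tower dominance and
eventual positivity of the even sector give the eventual parity margin with every slack `σ > 0`. [folklore] -/
theorem towerDominance_weil_eventualParityMargin
    (h : TowerDominance weilEvenGroundEnergy weilOddGroundEnergy)
    (hev : ∀ᶠ a in atTop, 0 < weilEvenGroundEnergy a) {σ : ℝ} (hσ : 0 < σ) :
    EventualParityMargin weilEvenGroundEnergy weilOddGroundEnergy σ :=
  h.eventualParityMargin hev hσ

end Summit.RiemannHypothesis.RiemannHypothesis.Theorems.PfPersistence

end
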